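import Mathlib
import Summits.ValiantsHypothesis.ValiantsHypothesis.Theorems.NewtonUnitEquationsDissociatedUniformTotalsLawConeCount
import Summits.ValiantsHypothesis.ValiantsHypothesis.Theorems.NewtonUnitEquationsDissociatedUniformTotalsLawTrigFibres
import HarnessLib

/-!
# Crux `NewtonUnitEquations.DissociatedUniform` (stmt-ValiantsHypothesis-5905): the FIRST POSITIVE POINTWISE LAW for triples —
# three sampled circles in the dominant regime have EVERY class hull of size `≤ 3q`

Memo `Cruxes/DissociatedUniform/NOTES-t1g8.md` §2 (the pointwise dichotomy on the smooth stratum: a contra-oriented FAN third polygon over a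
rigid pair holds `≈ q²/2` vertices in one class — kernel `…SmoothPointwise(13)`; co-oriented census `≤ 4q`, located `CoOrientedClassBound`) and
§5(i) (recommended next: the regular-pair sketch).  THIS FILE proves the positive side for the census extremisers of NOTES-d1g3 §3
themselves — `a, b, c` three sampled circles / regular `q`-gons with any centres, radii (`A² ≠ B²`, `A₃ ≠ 0`) and phases — in the
dominant-third-curve regime of `…LargeThirdPointwise`:

* `card_commonDir_le_add` (GENERAL `a, b`; `c` strictly convex ccw; fibres with sharp tops): `#{(z,x) : CommonDir} ≤ q + #{(z,x) : the
  edge {x, x+1} of P_{s−z} is exposed inside the cone K_z}` — summing the cone sweep count `…ConeCount.card_commonTop_le` over `z`;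
* `card_edgeHit_eq_of_rigid` (RIGID PAIRS): re-indexing by the shear `(u, x) ↦ (u − 2x, x)` and transporting along the pair rigidity
  `bpt (u−2x) (x+w) = o + R_x(bpt u w − o)` turns the edge count into `#{(u,x) : c(u−2x) is a weak top of C at R_x θ, θ exposing the edge
  {0,1} of P_{s−u}}` — the exposing direction being unique up to scale (`exposing_unique`);
* THREE CIRCLES: `c (w + x) = c₃ + R_x (c w − c₃)` makes the last condition `c(u − 3x)` a weak top at `θ`, so for `3 ∈ (ℤ/q)ˣ` each `u`
  contributes at most the `≤ 2` weak tops of `C` at one direction: **`card_commonDir_trig_le : #{CommonDir} ≤ 3q`**, hence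
  **`classVert_trig_smul_le : ∃ μ₀, ∀ μ ≥ μ₀, ∀ s, V_s(a, b, μ•c) ≤ 3q`** and **`totalVert_trig_smul_le : T(a, b, μ•c) ≤ 3q²`**.
So the `q²/2` phenomenon of NOTES-t1g8 §2 needs the UNEVEN cones of the fan: with a regular third polygon (either orientation is a unit
multiplier away) every class is `O(q)` pointwise.  The general co-oriented strictly convex third polygon (crossing number `3`, `V_s ≤ 4q`)
is the companion `…TotalsLawOneLap` (if landed).
Honest label: a pointwise law on a named family in the dominant regime; `CoOrientedClassBound`, `SmoothSharpTotalsLaw`, `TotalsLawThree`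
remain OPEN; nothing here bears on VP ≠ VNP.
[folklore]
-/

set_option linter.dupNamespace false -- `ValiantsHypothesis.ValiantsHypothesis` (summit = problem) in every name

open scoped BigOperators

namespace Summit.ValiantsHypothesis.ValiantsHypothesis.Theorems.NewtonUnitEquationsDissociatedUniform

namespace TotalsLaw

open Matrix Real

section RigidPairs

variable {q : ℕ} [NeZero q]

/-! #### From the common-direction count to the exposed-edge count (general curves) -/

/-- The edge `{x, x+1}` of the fibre `P_{s−z}` is EXPOSED INSIDE THE CONE of `c z`: some non-zero weight makes `c z` a weak top of `C`
and both `x`, `x + 1` weak tops of `P_{s−z}`. -/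
def EdgeHit (a b c : ZMod q → (Fin 2 → ℝ)) (s z x : ZMod q) : Prop :=
  ∃ θ : Fin 2 → ℝ, θ ≠ 0 ∧ WTop c θ z ∧ WTop (bpt a b s z) θ x ∧ WTop (bpt a b s z) θ (x + 1)

omit [NeZero q] in
/-- `CommonDir` in the weak-top vocabulary. [folklore] -/
theorem commonDir_iff_wTop (a b c : ZMod q → (Fin 2 → ℝ)) (s z x : ZMod q) :
    CommonDir a b c s z x ↔ ∃ θ : Fin 2 → ℝ, θ ≠ 0 ∧ WTop c θ z ∧ WTop (bpt a b s z) θ x := Iff.rfl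

/-- Counting over a product label by label. [folklore] -/
theorem card_filter_prod_eq_sum (p : ZMod q × ZMod q → Prop) [DecidablePred p] :
    (Finset.univ.filter p).card = ∑ z : ZMod q, (Finset.univ.filter fun x => p (z, x)).card := by
  simp only [Finset.card_filter]
  rw [Fintype.sum_prod_type]

open scoped Classical in
/-- **`#{CommonDir} ≤ q + #{exposed edges}`** for a strictly convex ccw third polygon (`q ≥ 3`) and fibres with sharp tops (ANY `a, b`):
the cone sweep count summed over the `q` cones. [folklore] -/
theorem card_commonDir_le_add (a b : ZMod q → (Fin 2 → ℝ)) {c : ZMod q → (Fin 2 → ℝ)} (hc : StrictlyConvexCcw c) (hq : 3 ≤ q)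
    (s : ZMod q) (hP : ∀ z, SharpTops (bpt a b s z)) :
    (Finset.univ.filter fun zx : ZMod q × ZMod q => CommonDir a b c s zx.1 zx.2).card ≤
      q + (Finset.univ.filter fun zx : ZMod q × ZMod q => EdgeHit a b c s zx.1 zx.2).card := by
  rw [card_filter_prod_eq_sum, card_filter_prod_eq_sum]
  calc ∑ z : ZMod q, (Finset.univ.filter fun x => CommonDir a b c s z x).card
      ≤ ∑ z : ZMod q, (1 + (Finset.univ.filter fun x => EdgeHit a b c s z x).card) :=
        Finset.sum_le_sum fun z _ => card_commonTop_le hc hq (hP z) z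
    _ = q + ∑ z : ZMod q, (Finset.univ.filter fun x => EdgeHit a b c s z x).card := by
        rw [Finset.sum_add_distrib, Finset.sum_const, Finset.card_univ, ZMod.card, smul_eq_mul, mul_one]

/-! #### Rigid pairs: shear re-indexing -/

/-- The shear `(u, x) ↦ (u − 2x, x)` of `ℤ/q × ℤ/q`. -/
def shear : ZMod q × ZMod q ≃ ZMod q × ZMod q where
  toFun p := (p.1 - 2 * p.2, p.2)
  invFun p := (p.1 + 2 * p.2, p.2)
  left_inv p := by simp
  right_inv p := by simp

/-- A pair `(a, b)` is RIGID with centre `o`: advancing both labels by `x` turns every fibre point by `2π·val x/q` about `o`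
(two sampled circles: `…TrigFibres.bpt_trigCurve_shift`). -/
def RigidPair (a b : ZMod q → (Fin 2 → ℝ)) (o : Fin 2 → ℝ) : Prop :=
  ∀ s u x w : ZMod q, bpt a b s (u - 2 * x) (x + w) = o + rot (2 * π * (x.val : ℝ) / q) (bpt a b s u w - o)

/-- Two sampled circles form a rigid pair. [folklore] -/
theorem rigidPair_trigCurve (c₁ c₂ : Fin 2 → ℝ) (A B φ ψ : ℝ) :
    RigidPair (trigCurve (q := q) c₁ A φ) (trigCurve c₂ B ψ) (c₁ + c₂) :=
  fun s u x w => bpt_trigCurve_shift c₁ c₂ A B φ ψ s u x w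

omit [NeZero q] in
/-- **Transport of the edge condition along the rigidity**: the edge `{x, x+1}` of `P_{s−(u−2x)}` is exposed inside `K_{u−2x}` iff some
weight `θ` exposing the edge `{0, 1}` of `P_{s−u}` has `c (u − 2x)` a weak top at the TURNED weight `R_x θ`. [folklore] -/
theorem edgeHit_shear_iff {a b : ZMod q → (Fin 2 → ℝ)} {o : Fin 2 → ℝ} (hab : RigidPair a b o) (c : ZMod q → (Fin 2 → ℝ))
    (s u x : ZMod q) :
    EdgeHit a b c s (u - 2 * x) x ↔ ∃ θ : Fin 2 → ℝ, θ ≠ 0 ∧ WTop c (rot (2 * π * (x.val : ℝ) / q) θ) (u - 2 * x) ∧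
      WTop (bpt a b s u) θ 0 ∧ WTop (bpt a b s u) θ 1 := by
  have hsh : ∀ w, bpt a b s (u - 2 * x) (x + w) = o + rot (2 * π * (x.val : ℝ) / q) (bpt a b s u w - o) :=
    fun w => hab s u x w
  constructor
  · rintro ⟨θ, hθ, hz, h0, h1⟩
    refine ⟨rot (-(2 * π * (x.val : ℝ) / q)) θ, rot_ne_zero _ hθ, ?_, ?_, ?_⟩
    · rwa [rot_rot, add_neg_cancel, rot_zero]
    · rw [← wTop_rot_shift hsh, rot_rot, add_neg_cancel, rot_zero, add_zero]; exact h0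
    · rw [← wTop_rot_shift hsh, rot_rot, add_neg_cancel, rot_zero]; exact h1
  · rintro ⟨θ, hθ, hz, h0, h1⟩
    refine ⟨rot (2 * π * (x.val : ℝ) / q) θ, rot_ne_zero _ hθ, hz, ?_, ?_⟩
    · have := (wTop_rot_shift hsh θ 0).2 h0; rwa [add_zero] at this
    · exact (wTop_rot_shift hsh θ 1).2 h1

open scoped Classical in
/-- **Shear re-indexing of the exposed-edge count** (rigid pairs). [folklore] -/
theorem card_edgeHit_eq_of_rigid {a b : ZMod q → (Fin 2 → ℝ)} {o : Fin 2 → ℝ} (hab : RigidPair a b o)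
    (c : ZMod q → (Fin 2 → ℝ)) (s : ZMod q) :
    (Finset.univ.filter fun zx : ZMod q × ZMod q => EdgeHit a b c s zx.1 zx.2).card =
      (Finset.univ.filter fun ux : ZMod q × ZMod q => ∃ θ : Fin 2 → ℝ, θ ≠ 0 ∧
        WTop c (rot (2 * π * (ux.2.val : ℝ) / q) θ) (ux.1 - 2 * ux.2) ∧ WTop (bpt a b s ux.1) θ 0 ∧ WTop (bpt a b s ux.1) θ 1).card := by
  symm
  refine Finset.card_equiv shear fun ux => ?_
  simp only [Finset.mem_filter, Finset.mem_univ, true_and, shear, Equiv.coe_fn_mk]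
  exact (edgeHit_shear_iff hab c s ux.1 ux.2).symm

/-! #### The exposing direction of an edge is unique up to scale -/

omit [NeZero q] in
/-- A vector orthogonal to `d ≠ 0` is a multiple of `perp d`: `v = (−det(d,v)/⟨d,d⟩)·perp d`. [folklore] -/
theorem eq_smul_perp_of_dotProduct_eq_zero {d v : Fin 2 → ℝ} (hd : d ≠ 0) (h : v ⬝ᵥ d = 0) :
    v = (-(cross2 d v) / (d ⬝ᵥ d)) • perp d := by
  have hD : 0 < d ⬝ᵥ d := by
    rw [dotProduct_fin_two]
    by_contra hle
    push Not at hle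
    have h0 : d 0 = 0 := by nlinarith
    have h1 : d 1 = 0 := by nlinarith
    exact hd (by ext i; fin_cases i <;> simp [h0, h1])
  rw [dotProduct_fin_two] at h hD ⊢
  have hne : d 0 * d 0 + d 1 * d 1 ≠ 0 := hD.ne'
  ext i
  fin_cases i
  · simp only [cross2, perp, Fin.zero_eta, Fin.isValue, Pi.smul_apply, Matrix.cons_val_zero, smul_eq_mul]
    rw [div_mul_eq_mul_div, eq_div_iff hne]
    linear_combination (d 0) * h
  · simp only [cross2, perp, Fin.mk_one, Fin.isValue, Pi.smul_apply, Matrix.cons_val_one, Matrix.cons_val_zero, smul_eq_mul]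
    rw [div_mul_eq_mul_div, eq_div_iff hne]
    linear_combination (d 1) * h

omit [NeZero q] in
/-- Consecutive vertices of a strictly convex polygon are distinct (`q ≥ 3`). [folklore] -/
theorem StrictlyConvexCcw.succ_ne {P : ZMod q → (Fin 2 → ℝ)} (hP : StrictlyConvexCcw P) (hq : 3 ≤ q) (z : ZMod q) :
    P (z + 1) ≠ P z := by
  intro h
  have h2ne : (2 : ZMod q) ≠ 0 := two_ne_zero_of_three_le hq
  have h1ne : (1 : ZMod q) ≠ 0 := one_ne_zero_of_three_le hq
  have := hP z (z + 2) (fun e => h2ne (by linear_combination e)) (fun e => h1ne (by linear_combination e))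
  rw [h, sub_self] at this
  simp [cross2] at this

omit [NeZero q] in
/-- **Uniqueness of the exposing direction.**  For a curve with sharp tops and `P 1 ≠ P 0` (`q ≥ 3`), two non-zero weights at which
both `0` and `1` are weak tops are positive multiples of each other. [folklore] -/
theorem exposing_unique {P : ZMod q → (Fin 2 → ℝ)} (hP : SharpTops P) (hq : 3 ≤ q) (h01 : P 1 ≠ P 0)
    {θ θ' : Fin 2 → ℝ} (hθ : θ ≠ 0) (hθ' : θ' ≠ 0) (h0 : WTop P θ 0) (h1 : WTop P θ 1) (h0' : WTop P θ' 0)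
    (h1' : WTop P θ' 1) : ∃ t : ℝ, 0 < t ∧ θ' = t • θ := by
  set d : Fin 2 → ℝ := P 1 - P 0 with hd
  have hd0 : d ≠ 0 := sub_ne_zero.2 h01
  have hθd : θ ⬝ᵥ d = 0 := by rw [hd, dotProduct_sub]; linarith [h0 1, h1 0]
  have hθ'd : θ' ⬝ᵥ d = 0 := by rw [hd, dotProduct_sub]; linarith [h0' 1, h1' 0]
  have eθ := eq_smul_perp_of_dotProduct_eq_zero hd0 hθd
  have eθ' := eq_smul_perp_of_dotProduct_eq_zero hd0 hθ'd
  have hDpos : 0 < d ⬝ᵥ d := by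
    rw [dotProduct_fin_two]
    by_contra hle
    push Not at hle
    have e0 : d 0 = 0 := by nlinarith
    have e1 : d 1 = 0 := by nlinarith
    exact hd0 (by ext i; fin_cases i <;> simp [e0, e1])
  have hcθ : cross2 d θ ≠ 0 := by
    intro h0c
    rw [h0c, neg_zero, zero_div, zero_smul] at eθ
    exact hθ eθ
  set t : ℝ := cross2 d θ' / cross2 d θ with ht
  have hθ't : θ' = t • θ := by
    rw [eθ', eθ, smul_smul]
    congr 1
    rw [ht]; field_simp
  have ht0 : t ≠ 0 := by
    intro h; rw [h, zero_smul] at hθ't; exact hθ' hθ't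
  refine ⟨t, ?_, hθ't⟩
  rcases lt_or_gt_of_ne ht0 with hneg | hpos
  · -- a negative multiple makes `0` both a weak top and a weak bottom of `θ`: every label is a weak top, three of them distinct
    exfalso
    have hall : ∀ w, WTop P θ w := by
      intro w y
      have e1 := h0 y
      have e2 := h0' w
      rw [hθ't, smul_dotProduct, smul_dotProduct, smul_eq_mul, smul_eq_mul] at e2
      have e3 : θ ⬝ᵥ P 0 ≤ θ ⬝ᵥ P w := by nlinarith
      have e4 := h0 w
      linarith
    have h1ne : (1 : ZMod q) ≠ 0 := one_ne_zero_of_three_le hq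
    have h2ne : (2 : ZMod q) ≠ 0 := two_ne_zero_of_three_le hq
    rcases (hP θ hθ).2 0 1 2 (hall 0) (hall 1) (hall 2) with h | h | h
    · exact h1ne h.symm
    · exact h1ne (by linear_combination -h)
    · exact h2ne h.symm
  · exact hpos

open scoped Classical in
/-- For a fixed `u`: the vertices `w` of `C` sharing a weak-top weight with the EDGE `{0,1}` of `P_{s−u}` number at most `2`
(all exposing weights are one direction; sharp tops of `C`). [folklore] -/
theorem card_wTop_exposing_le_two {c : ZMod q → (Fin 2 → ℝ)} (hc : SharpTops c) {P : ZMod q → (Fin 2 → ℝ)} (hP : SharpTops P)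
    (hq : 3 ≤ q) (h01 : P 1 ≠ P 0) :
    (Finset.univ.filter fun w : ZMod q =>
      ∃ θ : Fin 2 → ℝ, θ ≠ 0 ∧ WTop c θ w ∧ WTop P θ 0 ∧ WTop P θ 1).card ≤ 2 := by
  by_contra hgt
  obtain ⟨u, hu, v, hv, w, hw, huv, huw, hvw⟩ := Finset.two_lt_card.1 (not_le.1 hgt)
  simp only [Finset.mem_filter, Finset.mem_univ, true_and] at hu hv hw
  obtain ⟨θ, hθ, hcu, hu0, hu1⟩ := hu
  obtain ⟨θv, hθv, hcv, hv0, hv1⟩ := hv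
  obtain ⟨θw, hθw, hcw, hw0, hw1⟩ := hw
  obtain ⟨tv, htv, rfl⟩ := exposing_unique hP hq h01 hθ hθv hu0 hu1 hv0 hv1
  obtain ⟨tw, htw, rfl⟩ := exposing_unique hP hq h01 hθ hθw hu0 hu1 hw0 hw1
  rw [wTop_smul_iff c htv] at hcv
  rw [wTop_smul_iff c htw] at hcw
  rcases (hc θ hθ).2 u v w hcu hcv hcw with h | h | h
  · exact huv h
  · exact hvw h
  · exact huw h

/-! #### Three sampled circles -/

/-- For a sampled circle, a weak top at the turned weight is the shifted label: `WTop c (R_x θ) (x + w) ↔ WTop c θ w`. [folklore] -/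
theorem wTop_trigCurve_rot (c₃ : Fin 2 → ℝ) (A₃ φ₃ : ℝ) (θ : Fin 2 → ℝ) (x w : ZMod q) :
    WTop (trigCurve c₃ A₃ φ₃) (rot (2 * π * (x.val : ℝ) / q) θ) (x + w) ↔ WTop (trigCurve c₃ A₃ φ₃) θ w :=
  wTop_rot_shift (P := trigCurve c₃ A₃ φ₃) (fun w' => by rw [add_comm]; exact trigCurve_add_eq_rot c₃ A₃ φ₃ w' x) θ w

open scoped Classical in
/-- **`#{CommonDir} ≤ 3q` for three sampled circles** (`B² < A²`, `A₃ ≠ 0`, `q ≥ 3`, `3` a unit mod `q`). [folklore] -/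
theorem card_commonDir_trig_le (hq : 3 ≤ q) (h3 : IsUnit (3 : ZMod q)) (c₁ c₂ c₃ : Fin 2 → ℝ) {A B A₃ : ℝ}
    (hAB : B ^ 2 < A ^ 2) (hA₃ : A₃ ≠ 0) (φ ψ φ₃ : ℝ) (s : ZMod q) :
    (Finset.univ.filter fun zx : ZMod q × ZMod q =>
      CommonDir (trigCurve c₁ A φ) (trigCurve c₂ B ψ) (trigCurve c₃ A₃ φ₃) s zx.1 zx.2).card ≤ 3 * q := by
  set a := trigCurve (q := q) c₁ A φ with ha
  set b := trigCurve (q := q) c₂ B ψ with hb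
  set c := trigCurve (q := q) c₃ A₃ φ₃ with hcdef
  have hc : StrictlyConvexCcw c := strictlyConvexCcw_trigCurve hq c₃ hA₃ φ₃
  have hcS : SharpTops c := sharpTops_of_strictlyConvexCcw hc hq
  have hPconv : ∀ z, StrictlyConvexCcw (bpt a b s z) := fun z => strictlyConvexCcw_bpt_trigCurve hq c₁ c₂ hAB φ ψ s z
  have hP : ∀ z, SharpTops (bpt a b s z) := fun z => sharpTops_of_strictlyConvexCcw (hPconv z) hq
  have hab : RigidPair a b (c₁ + c₂) := rigidPair_trigCurve c₁ c₂ A B φ ψ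
  -- the exposed-edge count after shearing, with the turned weight absorbed into a label shift of the circle `c`
  set CE : ZMod q → ZMod q → Prop := fun u w =>
    ∃ θ : Fin 2 → ℝ, θ ≠ 0 ∧ WTop c θ w ∧ WTop (bpt a b s u) θ 0 ∧ WTop (bpt a b s u) θ 1 with hCE
  have hiff : ∀ ux : ZMod q × ZMod q, (∃ θ : Fin 2 → ℝ, θ ≠ 0 ∧
      WTop c (rot (2 * π * (ux.2.val : ℝ) / q) θ) (ux.1 - 2 * ux.2) ∧ WTop (bpt a b s ux.1) θ 0 ∧ WTop (bpt a b s ux.1) θ 1) ↔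
      CE ux.1 (ux.1 - 3 * ux.2) := by
    intro ux
    have e : ux.1 - 2 * ux.2 = ux.2 + (ux.1 - 3 * ux.2) := by ring
    simp only [hCE, e, hcdef, wTop_trigCurve_rot]
  have h1 : (Finset.univ.filter fun zx : ZMod q × ZMod q => EdgeHit a b c s zx.1 zx.2).card =
      (Finset.univ.filter fun ux : ZMod q × ZMod q => CE ux.1 (ux.1 - 3 * ux.2)).card := by
    rw [card_edgeHit_eq_of_rigid hab c s]
    exact congrArg Finset.card (Finset.filter_congr fun ux _ => hiff ux)
  -- `x ↦ u − 3x` is injective: compare with the count over `(u, w)`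
  have h2 : (Finset.univ.filter fun ux : ZMod q × ZMod q => CE ux.1 (ux.1 - 3 * ux.2)).card ≤
      (Finset.univ.filter fun uw : ZMod q × ZMod q => CE uw.1 uw.2).card := by
    refine Finset.card_le_card_of_injOn (fun ux => (ux.1, ux.1 - 3 * ux.2)) (fun ux hux => ?_) ?_
    · simp only [Finset.coe_filter, Finset.mem_univ, true_and, Set.mem_setOf_eq] at hux ⊢
      exact hux
    · intro ux _ ux' _ h
      simp only [Prod.mk.injEq] at h
      obtain ⟨hu, hw⟩ := h
      have h3x : (3 : ZMod q) * ux.2 = 3 * ux'.2 := by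
        rw [hu] at hw
        linear_combination -hw
      exact Prod.ext hu (h3.mul_left_cancel h3x)
  -- per `u`: at most two vertices of `C`
  have h01 : ∀ u, bpt a b s u 1 ≠ bpt a b s u 0 := fun u => by
    have := (hPconv u).succ_ne hq 0
    rwa [zero_add] at this
  have h3' : (Finset.univ.filter fun uw : ZMod q × ZMod q => CE uw.1 uw.2).card ≤ 2 * q := by
    rw [card_filter_prod_eq_sum]
    calc ∑ u : ZMod q, (Finset.univ.filter fun w => CE u w).card ≤ ∑ u : ZMod q, 2 :=
          Finset.sum_le_sum fun u _ => card_wTop_exposing_le_two hcS (hP u) hq (h01 u)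
      _ = 2 * q := by rw [Finset.sum_const, Finset.card_univ, ZMod.card, smul_eq_mul, mul_comm]
  calc (Finset.univ.filter fun zx : ZMod q × ZMod q => CommonDir a b c s zx.1 zx.2).card
      ≤ q + (Finset.univ.filter fun zx : ZMod q × ZMod q => EdgeHit a b c s zx.1 zx.2).card :=
        card_commonDir_le_add a b hc hq s hP
    _ ≤ q + 2 * q := by rw [h1]; exact Nat.add_le_add_left (h2.trans h3') q
    _ = 3 * q := by ring

omit [NeZero q] in
/-- Transposition symmetry of `V_s`. [folklore] -/
theorem classVert_swap (a b c : ZMod q → (Fin 2 → ℝ)) (s : ZMod q) : classVert a b c s = classVert b a c s := by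
  unfold classVert; rw [classPts_swap]

/-- **THE POINTWISE LAW FOR THREE SAMPLED CIRCLES, one class** (dominant regime): for `a, b, c` sampled circles with `A² ≠ B²`, `A₃ ≠ 0`,
`q ≥ 3`, `3 ∈ (ℤ/q)ˣ`, and every class `s`, there is `μ₀` with `V_s(a, b, μ•c) ≤ 3q` for all `μ ≥ μ₀`. [folklore] -/
theorem classVert_trig_smul_le_of_class (hq : 3 ≤ q) (h3 : IsUnit (3 : ZMod q)) (c₁ c₂ c₃ : Fin 2 → ℝ) {A B A₃ : ℝ}
    (hAB : A ^ 2 ≠ B ^ 2) (hA₃ : A₃ ≠ 0) (φ ψ φ₃ : ℝ) (s : ZMod q) :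
    ∃ μ₀ : ℝ, ∀ μ : ℝ, μ₀ ≤ μ →
      classVert (trigCurve c₁ A φ) (trigCurve c₂ B ψ) (μ • trigCurve c₃ A₃ φ₃) s ≤ 3 * q := by
  classical
  rcases lt_or_gt_of_ne hAB with hlt | hgt
  · -- `A² < B²`: swap the two circles
    obtain ⟨μ₀, hμ₀⟩ := classVert_smul_le_card_commonDir (trigCurve (q := q) c₂ B ψ) (trigCurve c₁ A φ) (trigCurve c₃ A₃ φ₃) s
    refine ⟨μ₀, fun μ hμ => ?_⟩
    rw [classVert_swap]
    exact (hμ₀ μ hμ).trans (card_commonDir_trig_le hq h3 c₂ c₁ c₃ hlt hA₃ ψ φ φ₃ s)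
  · obtain ⟨μ₀, hμ₀⟩ := classVert_smul_le_card_commonDir (trigCurve (q := q) c₁ A φ) (trigCurve c₂ B ψ) (trigCurve c₃ A₃ φ₃) s
    exact ⟨μ₀, fun μ hμ => (hμ₀ μ hμ).trans (card_commonDir_trig_le hq h3 c₁ c₂ c₃ hgt hA₃ φ ψ φ₃ s)⟩

/-- **THE POINTWISE LAW FOR THREE SAMPLED CIRCLES** (dominant regime, all classes at once): `∃ μ₀, ∀ μ ≥ μ₀, ∀ s, V_s(a, b, μ•c) ≤ 3q`.
The first positive pointwise statement for triples (NOTES-t1g8 §5(i)); contrast `…SmoothPointwise` (a contra-oriented FAN over a rigid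
pair: one class `≥ q²/2`). [folklore] -/
theorem classVert_trig_smul_le (hq : 3 ≤ q) (h3 : IsUnit (3 : ZMod q)) (c₁ c₂ c₃ : Fin 2 → ℝ) {A B A₃ : ℝ}
    (hAB : A ^ 2 ≠ B ^ 2) (hA₃ : A₃ ≠ 0) (φ ψ φ₃ : ℝ) :
    ∃ μ₀ : ℝ, ∀ μ : ℝ, μ₀ ≤ μ → ∀ s : ZMod q,
      classVert (trigCurve c₁ A φ) (trigCurve c₂ B ψ) (μ • trigCurve c₃ A₃ φ₃) s ≤ 3 * q := by
  choose f hf using fun s => classVert_trig_smul_le_of_class hq h3 c₁ c₂ c₃ hAB hA₃ φ ψ φ₃ s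
  refine ⟨Finset.univ.sup' Finset.univ_nonempty f, fun μ hμ s => hf s μ ?_⟩
  exact (Finset.le_sup' f (Finset.mem_univ s)).trans hμ

/-- **Totals form**: `T(a, b, μ•c) ≤ 3q²` for three sampled circles in the dominant regime (`3 ∈ (ℤ/q)ˣ`). [folklore] -/
theorem totalVert_trig_smul_le (hq : 3 ≤ q) (h3 : IsUnit (3 : ZMod q)) (c₁ c₂ c₃ : Fin 2 → ℝ) {A B A₃ : ℝ}
    (hAB : A ^ 2 ≠ B ^ 2) (hA₃ : A₃ ≠ 0) (φ ψ φ₃ : ℝ) :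
    ∃ μ₀ : ℝ, ∀ μ : ℝ, μ₀ ≤ μ →
      totalVert (trigCurve (q := q) c₁ A φ) (trigCurve c₂ B ψ) (μ • trigCurve c₃ A₃ φ₃) ≤ 3 * q ^ 2 := by
  obtain ⟨μ₀, hμ₀⟩ := classVert_trig_smul_le hq h3 c₁ c₂ c₃ hAB hA₃ φ ψ φ₃
  refine ⟨μ₀, fun μ hμ => ?_⟩
  unfold totalVert
  calc ∑ s, classVert (trigCurve (q := q) c₁ A φ) (trigCurve c₂ B ψ) (μ • trigCurve c₃ A₃ φ₃) s ≤ ∑ _s : ZMod q, 3 * q :=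
        Finset.sum_le_sum fun s _ => hμ₀ μ hμ s
    _ = 3 * q ^ 2 := by rw [Finset.sum_const, Finset.card_univ, ZMod.card, smul_eq_mul]; ring

omit [NeZero q] in
/-- The unit hypothesis from coprimality: `3 ∈ (ℤ/q)ˣ` when `gcd(3, q) = 1`. [folklore] -/
theorem isUnit_three_of_coprime (h : Nat.Coprime 3 q) : IsUnit (3 : ZMod q) := by
  have := (ZMod.isUnit_iff_coprime 3 q).2 h
  exact_mod_cast this

end RigidPairs

end TotalsLaw

end Summit.ValiantsHypothesis.ValiantsHypothesis.Theorems.NewtonUnitEquationsDissociatedUniform
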